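import Mathlib
import Literature.NumberTheory.EllipticCurves.CuspFormsGamma1EisensteinDivision
import Literature.NumberTheory.EllipticCurves.KleinJIntegralQExpansion
import Literature.NumberTheory.Transcendental.SixExponentialsPadicProofs
import Summits.Langlands.Langlands.Theorems.CapacityClassicalityIntegralOverconvergentIsCongruenceKatzData

/-!
# Katz data for the auxiliary forms and the resulting `p`-adic gain (stub `stub_katzGain`)

Route `CapacityClassicality`, crux `IntegralOverconvergentIsCongruence` (item stmt-Langlands-8457),
line `Sketch`.

A *Katz datum* of weight `w`, rate `r`, constant `C'` on `Γ₁(N)` for a complex `q`-series `F` is a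
family `c' : ℕ → ℂ⟦q⟧` with `c'ᵢ` the `q`-expansion of a classical form of weight `w + i(p-1)` on
`Γ₁(N)`, `ι`-adic bounds `‖ι⁻¹ aₙ(c'ᵢ)‖ ≤ C' p^{-ri}`, and `∑ᵢ c'ᵢ E_{p-1}^{-i} = F` coefficientwise
along `ι⁻¹` (as `HasSum`s in `ℚ̄_p`).  Packaging a datum as its generating series
`Φ = ∑ᵢ c'ᵢ Tⁱ ∈ ℂ⟦q⟧⟦T⟧`, the three conditions are stable under products (helper file
`CapacityClassicalityIntegralOverconvergentIsCongruenceKatzData`: `katzFormFamily_mul`,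
`katzNormFamily_mul`, `katzSumFamily_mul` — the Cauchy product, the ultrametric inequality, and
`HasSum.mul_of_nonarchimedean` in the non-complete but nonarchimedean field `ℚ̄_p`), hence under
powers and finite sums of equal weight; constants, `E₄³` and `Δ` carry the obvious one-term data.
Consequently every auxiliary form `F_P = ∑ P_{ij} E₄^{3i} Δ^{D₁-i} (g¹² Δ^{k⁻})ʲ (Δ^{k⁺})^{D₂-j}`
carries a datum of weight `12 D₁ + 12 k⁺ D₂` and constant `max(C,1)^{12 D₂}`, and the Katz–Sturm
gain (hypothesis `hKS`, the neighbouring stub `stub_katzSturm`) yields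
`‖ι⁻¹σ₀ a_M(F_P)‖ ≤ A · B^{D₁+D₂} · R⁻¹^M` with explicit `A > 0`, `B ≥ 1`,
`R = p^{12r/((p-1)μ)} > 1`.
-/

set_option linter.dupNamespace false -- project-wide option (lakefile weak.linter.dupNamespace); `Summit.Langlands.Langlands` is the mandated namespace

open scoped MatrixGroups Manifold Topology
open UpperHalfPlane CongruenceSubgroup Metric PowerSeries
open Literature.NumberTheory.EllipticCurves Literature.NumberTheory.EllipticCurves.ModularForms

noncomputable section

namespace Summit.Langlands.Langlands.Theorems.CapacityClassicality

/-! ## The stub -/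

/-- **K4 — Katz data for the auxiliary forms, and the resulting gain.** From the crux's Katz datum
for `g = Σ σ₀(aₙ)qⁿ` (weight `k`, rate `r`, constant `C`) and the Katz–Sturm gain in the shape
proved by `stub_katzSturm` (`hKS`), every auxiliary form
`F_P = Σ P_{ij} E₄^{3i} Δ^{D₁-i} (g¹² Δ^{k⁻})ʲ (Δ^{k⁺})^{D₂-j}` (`P_{ij} ∈ 𝓞_E`) vanishing below
order `M` has `‖ι⁻¹σ₀ a_M(F_P)‖ ≤ A · B^{D₁+D₂} · R⁻¹^M` for constants `A > 0`, `B ≥ 1`, `R > 1`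
independent of `P`, `M`. Here `Z₁, Z₂ ∈ ℤ⟦q⟧` are the q-expansions of `E₄³` and `Δ`.

Proof: Katz data form a graded ring (`katzFormFamily_mul`, `katzNormFamily_mul`,
`katzSumFamily_mul`), so
`F_P` carries a datum of weight `12 D₁ + 12 k⁺ D₂` (`k + k⁻ = k⁺`) and constant `max(C,1)^{12 D₂}`;
feed it through `hKS` and take `A = p^{(r/(p-1))(12 - 12/μ)}`,
`B = max(C,1)^{12} p^{12 r (k⁺+1)/(p-1)}`, `R = p^{12 r/((p-1) μ)}`, `μ = [SL₂(ℤ) : Γ₁(N)]`. -/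
theorem stub_katzGain (p : ℕ) [Fact p.Prime] (hp : 5 ≤ p) (N : ℕ) [NeZero N]
    (k : ℤ) (ι : PadicAlgCl p ≃+* ℂ) (E : Type) [Field E] [NumberField E] (σ₀ : E →+* ℂ)
    (a : ℕ → E) (hint : ∀ n, IsIntegral ℤ (a n))
    (r C : ℝ) (c : ℕ → PowerSeries ℂ) (hr : 0 < r)
    (hc₁ : ∀ i : ℕ, ∃ F : ModularForm (CongruenceSubgroup.Gamma1 N) (k + i * (p - 1 : ℕ)),
      c i = qExpansion 1 ⇑F)
    (hc₂ : ∀ i n : ℕ, ‖ι.symm (coeff n (c i))‖ ≤ C * (p : ℝ) ^ (-(r * i)))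
    (hc₃ : ∀ n : ℕ, HasSum (fun i : ℕ ↦ ι.symm (coeff n
      (c i * ((qExpansion 1 ⇑(ModularForm.E (show 3 ≤ p - 1 by omega)))⁻¹) ^ i)))
      (ι.symm (σ₀ (a n))))
    (Z₁ Z₂ : PowerSeries ℤ)
    (hZ₁ : Z₁.map (Int.castRingHom ℂ) = (qExpansion 1 ⇑ModularForm.E₄) ^ 3)
    (hZ₂ : Z₂.map (Int.castRingHom ℂ) = qExpansion 1 ⇑CuspForm.discriminant)
    (hKS : ∀ (w : ℤ) (C' : ℝ) (c' : ℕ → PowerSeries ℂ) (F : PowerSeries ℂ), 0 ≤ C' →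
      (∀ i : ℕ, ∃ G : ModularForm (CongruenceSubgroup.Gamma1 N) (w + i * (p - 1 : ℕ)),
        c' i = qExpansion 1 ⇑G) →
      (∀ i n : ℕ, ‖ι.symm (coeff n (c' i))‖ ≤ C' * (p : ℝ) ^ (-(r * i))) →
      (∀ n : ℕ, HasSum (fun i : ℕ ↦ ι.symm (coeff n
        (c' i * ((qExpansion 1 ⇑(ModularForm.E (show 3 ≤ p - 1 by omega)))⁻¹) ^ i)))
        (ι.symm (coeff n F))) →
      ∀ M : ℕ, (∀ m, m < M → coeff m F = 0) →
        ‖ι.symm (coeff M F)‖ ≤ C' * (p : ℝ) ^ (r / ((p : ℝ) - 1) *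
          ((w : ℝ) + 12 - 12 * ((M : ℝ) + 1) / ((CongruenceSubgroup.Gamma1 N).index : ℝ)))) :
    ∃ A B R : ℝ, 0 < A ∧ 1 ≤ B ∧ 1 < R ∧
      ∀ (D₁ D₂ : ℕ) (P : Fin (D₁ + 1) → Fin (D₂ + 1) → E), (∀ i j, IsIntegral ℤ (P i j)) →
      ∀ M : ℕ,
        (∀ m, m < M → coeff m (∑ i : Fin (D₁ + 1), ∑ j : Fin (D₂ + 1),
          PowerSeries.C (P i j) * (Z₁.map (Int.castRingHom E)) ^ (i : ℕ) *
            (Z₂.map (Int.castRingHom E)) ^ (D₁ - i) *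
            ((PowerSeries.mk a) ^ 12 * (Z₂.map (Int.castRingHom E)) ^ (-k).toNat) ^ (j : ℕ) *
            ((Z₂.map (Int.castRingHom E)) ^ k.toNat) ^ (D₂ - j)) = 0) →
        ‖ι.symm (σ₀ (coeff M (∑ i : Fin (D₁ + 1), ∑ j : Fin (D₂ + 1),
          PowerSeries.C (P i j) * (Z₁.map (Int.castRingHom E)) ^ (i : ℕ) *
            (Z₂.map (Int.castRingHom E)) ^ (D₁ - i) *
            ((PowerSeries.mk a) ^ 12 * (Z₂.map (Int.castRingHom E)) ^ (-k).toNat) ^ (j : ℕ) *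
            ((Z₂.map (Int.castRingHom E)) ^ k.toNat) ^ (D₂ - j))))‖
          ≤ A * B ^ (D₁ + D₂) * R⁻¹ ^ M := by
  classical
  have _ := hint
  -- the constants
  have hx : (1 : ℝ) < p := by exact_mod_cast (show 1 < p by omega)
  have hx0 : (0 : ℝ) < p := by linarith
  have hd : (0 : ℝ) < (p : ℝ) - 1 := by linarith
  have hμ : (1 : ℝ) ≤ ((CongruenceSubgroup.Gamma1 N).index : ℝ) := by
    exact_mod_cast Nat.one_le_iff_ne_zero.mpr Subgroup.FiniteIndex.index_ne_zero
  have hμ0 : (0 : ℝ) < ((CongruenceSubgroup.Gamma1 N).index : ℝ) := by linarith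
  have hC₀ : (1 : ℝ) ≤ max C 1 := le_max_right C 1
  have hkp : (0 : ℝ) ≤ (k.toNat : ℝ) := Nat.cast_nonneg _
  refine ⟨(p : ℝ) ^ (r / ((p : ℝ) - 1) * (12 - 12 / ((CongruenceSubgroup.Gamma1 N).index : ℝ))),
    max C 1 ^ 12 * (p : ℝ) ^ (12 * r * ((k.toNat : ℝ) + 1) / ((p : ℝ) - 1)),
    (p : ℝ) ^ (12 * r / (((p : ℝ) - 1) * ((CongruenceSubgroup.Gamma1 N).index : ℝ))),
    Real.rpow_pos_of_pos hx0 _,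
    one_le_mul_of_one_le_of_one_le (one_le_pow₀ hC₀) (Real.one_le_rpow hx.le (by positivity)),
    Real.one_lt_rpow hx (div_pos (by positivity) (mul_pos hd hμ0)), ?_⟩
  intro D₁ D₂ P hP M hM
  have hCP0 : (0 : ℝ) ≤ (max C 1 ^ 12) ^ D₂ := by positivity
  -- the level-one inputs
  have hq1 : qExpansion 1 ⇑(ofLevelOne (CongruenceSubgroup.Gamma1 N) E₄cube) =
      (qExpansion 1 ⇑ModularForm.E₄) ^ 3 := by
    rw [coe_ofLevelOne, E₄cube, ModularForm.qExpansion_mcast]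
    exact ModularForm.qExpansion_pow one_pos (by simp) _ 3
  have hq2 : qExpansion 1 ⇑(ofLevelOne (CongruenceSubgroup.Gamma1 N) delta) =
      qExpansion 1 ⇑CuspForm.discriminant := rfl
  have hqe : ∀ e : ℂ,
      qExpansion 1 ⇑(e • (1 : ModularForm (CongruenceSubgroup.Gamma1 N) 0)) = PowerSeries.C e := by
    intro e
    rw [ModularForm.IsGLPos.coe_smul, ModularForm.qExpansion_smul one_pos (by simp) e
      (1 : ModularForm (CongruenceSubgroup.Gamma1 N) 0), ModularForm.qExpansion_one,
      smul_eq_C_mul, mul_one]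
  -- transport along `σ₀`
  have hmapZ : ∀ Z : PowerSeries ℤ, PowerSeries.map σ₀ (PowerSeries.map (Int.castRingHom E) Z) =
      PowerSeries.map (Int.castRingHom ℂ) Z := fun Z ↦ by
    ext n
    simp [PowerSeries.coeff_map]
  have hmapg : PowerSeries.map σ₀ (PowerSeries.mk a) = PowerSeries.mk (fun n ↦ σ₀ (a n)) := by
    ext n
    simp [PowerSeries.coeff_map]
  have hFmap : PowerSeries.map σ₀ (∑ i : Fin (D₁ + 1), ∑ j : Fin (D₂ + 1),
      PowerSeries.C (P i j) * (Z₁.map (Int.castRingHom E)) ^ (i : ℕ) *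
        (Z₂.map (Int.castRingHom E)) ^ (D₁ - i) *
        ((PowerSeries.mk a) ^ 12 * (Z₂.map (Int.castRingHom E)) ^ (-k).toNat) ^ (j : ℕ) *
        ((Z₂.map (Int.castRingHom E)) ^ k.toNat) ^ (D₂ - j)) =
      ∑ i : Fin (D₁ + 1), ∑ j : Fin (D₂ + 1),
        PowerSeries.C (σ₀ (P i j)) * ((qExpansion 1 ⇑ModularForm.E₄) ^ 3) ^ (i : ℕ) *
          (qExpansion 1 ⇑CuspForm.discriminant) ^ (D₁ - i) *
          ((PowerSeries.mk fun n ↦ σ₀ (a n)) ^ 12 *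
            (qExpansion 1 ⇑CuspForm.discriminant) ^ (-k).toNat) ^ (j : ℕ) *
          ((qExpansion 1 ⇑CuspForm.discriminant) ^ k.toNat) ^ (D₂ - j) := by
    simp only [map_sum, map_mul, map_pow, PowerSeries.map_C, hmapZ, hZ₁, hZ₂, hmapg]
  rw [← PowerSeries.coeff_map, hFmap]
  -- generalize the inputs
  generalize (qExpansion 1 ⇑ModularForm.E₄) ^ 3 = X₁ at hq1 hZ₁ hFmap ⊢
  generalize qExpansion 1 ⇑CuspForm.discriminant = X₂ at hq2 hZ₂ hFmap ⊢
  generalize (qExpansion 1 ⇑(ModularForm.E (show 3 ≤ p - 1 by omega)))⁻¹ = Q at hc₃ hKS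
  -- basic data: `g`
  have hg1 : ∀ i : ℕ, ∃ G' : ModularForm (CongruenceSubgroup.Gamma1 N) (k + i * (p - 1 : ℕ)),
      coeff i (PowerSeries.mk c) = qExpansion 1 ⇑G' := fun i ↦ by
    rw [PowerSeries.coeff_mk]
    exact hc₁ i
  have hg2 : ∀ i n : ℕ, ‖ι.symm (coeff n (coeff i (PowerSeries.mk c)))‖ ≤
      max C 1 * (p : ℝ) ^ (-(r * i)) :=
    katzNormFamily_mono ι r (le_max_left C 1) fun i n ↦ by
      rw [PowerSeries.coeff_mk]
      exact hc₂ i n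
  have hg3 : ∀ n : ℕ, HasSum (fun i : ℕ ↦ ι.symm (coeff n (coeff i (PowerSeries.mk c) * Q ^ i)))
      (ι.symm (coeff n (PowerSeries.mk fun n ↦ σ₀ (a n)))) := fun n ↦ by
    simp only [PowerSeries.coeff_mk]
    exact hc₃ n
  generalize (PowerSeries.mk fun n ↦ σ₀ (a n)) = G at hg3 hFmap ⊢
  -- basic data: `E₄³` and `Δ`
  have h11 : ∀ i : ℕ, ∃ G' : ModularForm (CongruenceSubgroup.Gamma1 N) (12 + i * (p - 1 : ℕ)),
      coeff i (PowerSeries.C X₁) = qExpansion 1 ⇑G' := by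
    have := katzFormFamily_C (p - 1) (ofLevelOne (CongruenceSubgroup.Gamma1 N) E₄cube)
    rwa [hq1] at this
  have h12 : ∀ i n : ℕ,
      ‖ι.symm (coeff n (coeff i (PowerSeries.C X₁)))‖ ≤ 1 * (p : ℝ) ^ (-(r * i)) :=
    katzNormFamily_C ι r fun n ↦ by
      rw [← hZ₁, PowerSeries.coeff_map, eq_intCast, map_intCast]
      exact IsUltrametricDist.norm_intCast_le_one _ _
  have h13 := katzSumFamily_C ι Q X₁
  have h21 : ∀ i : ℕ, ∃ G' : ModularForm (CongruenceSubgroup.Gamma1 N) (12 + i * (p - 1 : ℕ)),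
      coeff i (PowerSeries.C X₂) = qExpansion 1 ⇑G' := by
    have := katzFormFamily_C (p - 1) (ofLevelOne (CongruenceSubgroup.Gamma1 N) delta)
    rwa [hq2] at this
  have h22 : ∀ i n : ℕ,
      ‖ι.symm (coeff n (coeff i (PowerSeries.C X₂)))‖ ≤ 1 * (p : ℝ) ^ (-(r * i)) :=
    katzNormFamily_C ι r fun n ↦ by
      rw [← hZ₂, PowerSeries.coeff_map, eq_intCast, map_intCast]
      exact IsUltrametricDist.norm_intCast_le_one _ _
  have h23 := katzSumFamily_C ι Q X₂
  -- basic data: the scalars `σ₀ (P i j)`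
  have he1 : ∀ e : ℂ, ∀ i : ℕ,
      ∃ G' : ModularForm (CongruenceSubgroup.Gamma1 N) (0 + i * (p - 1 : ℕ)),
        coeff i (PowerSeries.C (PowerSeries.C e)) = qExpansion 1 ⇑G' := fun e ↦ by
    have := katzFormFamily_C (p - 1) (e • (1 : ModularForm (CongruenceSubgroup.Gamma1 N) 0))
    rwa [hqe e] at this
  have he2 : ∀ (i : Fin (D₁ + 1)) (j : Fin (D₂ + 1)), ∀ l n : ℕ,
      ‖ι.symm (coeff n (coeff l (PowerSeries.C (PowerSeries.C (σ₀ (P i j))))))‖ ≤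
        1 * (p : ℝ) ^ (-(r * l)) :=
    fun i j ↦ katzNormFamily_C ι r fun n ↦ by
      rw [PowerSeries.coeff_C]
      split_ifs
      · exact Literature.NumberTheory.Transcendental.SixExpPadic.norm_le_one_of_isIntegral (ℓ := p)
          (map_isIntegral_int ((ι.symm : ℂ ≃+* PadicAlgCl p).toRingHom.comp σ₀) (hP i j))
      · simp
  -- the monomials
  obtain ⟨Φm, hΦm⟩ : ∃ Φm : Fin (D₁ + 1) → Fin (D₂ + 1) → PowerSeries (PowerSeries ℂ),
      ∀ i j, Φm i j = PowerSeries.C (PowerSeries.C (σ₀ (P i j))) * PowerSeries.C X₁ ^ (i : ℕ) *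
        PowerSeries.C X₂ ^ (D₁ - i) *
        ((PowerSeries.mk c) ^ 12 * PowerSeries.C X₂ ^ (-k).toNat) ^ (j : ℕ) *
        (PowerSeries.C X₂ ^ k.toNat) ^ (D₂ - j) :=
    ⟨_, fun _ _ ↦ rfl⟩
  have hm1 : ∀ (i : Fin (D₁ + 1)) (j : Fin (D₂ + 1)), ∀ l : ℕ,
      ∃ G' : ModularForm (CongruenceSubgroup.Gamma1 N)
        ((12 * D₁ + 12 * k.toNat * D₂ : ℤ) + l * (p - 1 : ℕ)),
        coeff l (Φm i j) = qExpansion 1 ⇑G' := fun i j ↦ by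
    rw [hΦm]
    refine katzFormFamily_congr (p - 1) ?_
      (katzFormFamily_mul _ (katzFormFamily_mul _ (katzFormFamily_mul _
        (katzFormFamily_mul _ (he1 _) (katzFormFamily_pow _ h11 _)) (katzFormFamily_pow _ h21 _))
        (katzFormFamily_pow _
          (katzFormFamily_mul _ (katzFormFamily_pow _ hg1 12) (katzFormFamily_pow _ h21 _)) _))
        (katzFormFamily_pow _ (katzFormFamily_pow _ h21 _) _))
    have hkk : k + ((-k).toNat : ℤ) = (k.toNat : ℤ) := by omega
    push_cast [Nat.cast_sub i.is_le, Nat.cast_sub j.is_le]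
    linear_combination (12 * ((j : ℕ) : ℤ)) * hkk
  have hm2 : ∀ (i : Fin (D₁ + 1)) (j : Fin (D₂ + 1)), ∀ l n : ℕ,
      ‖ι.symm (coeff n (coeff l (Φm i j)))‖ ≤ (max C 1 ^ 12) ^ D₂ * (p : ℝ) ^ (-(r * l)) :=
    fun i j ↦ by
    rw [hΦm]
    refine katzNormFamily_mono ι r ?_
      (katzNormFamily_mul ι r (katzNormFamily_mul ι r (katzNormFamily_mul ι r
        (katzNormFamily_mul ι r (he2 i j) (katzNormFamily_pow ι r h12 _))
        (katzNormFamily_pow ι r h22 _))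
        (katzNormFamily_pow ι r (katzNormFamily_mul ι r (katzNormFamily_pow ι r hg2 12)
          (katzNormFamily_pow ι r h22 _)) _))
        (katzNormFamily_pow ι r (katzNormFamily_pow ι r h22 _) _))
    simp only [one_pow, one_mul, mul_one]
    exact pow_le_pow_right₀ (one_le_pow₀ hC₀) j.is_le
  have hm3 : ∀ (i : Fin (D₁ + 1)) (j : Fin (D₂ + 1)), ∀ n : ℕ,
      HasSum (fun l : ℕ ↦ ι.symm (coeff n (coeff l (Φm i j) * Q ^ l)))
        (ι.symm (coeff n (PowerSeries.C (σ₀ (P i j)) * X₁ ^ (i : ℕ) * X₂ ^ (D₁ - i) *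
          (G ^ 12 * X₂ ^ (-k).toNat) ^ (j : ℕ) * (X₂ ^ k.toNat) ^ (D₂ - j)))) := fun i j ↦ by
    rw [hΦm]
    exact katzSumFamily_mul ι Q (katzSumFamily_mul ι Q (katzSumFamily_mul ι Q (katzSumFamily_mul ι Q
      (katzSumFamily_C ι Q _) (katzSumFamily_pow ι Q h13 _)) (katzSumFamily_pow ι Q h23 _))
      (katzSumFamily_pow ι Q
        (katzSumFamily_mul ι Q (katzSumFamily_pow ι Q hg3 12) (katzSumFamily_pow ι Q h23 _)) _))
      (katzSumFamily_pow ι Q (katzSumFamily_pow ι Q h23 _) _)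
  -- the auxiliary form `F_P`: a datum of weight `12 D₁ + 12 k⁺ D₂`, constant `max(C,1)^{12 D₂}`
  have hS1 := katzFormFamily_sum (p - 1) Finset.univ _ fun i _ ↦
    katzFormFamily_sum (p - 1) Finset.univ _ fun j _ ↦ hm1 i j
  have hS2 := katzNormFamily_sum ι r hCP0 Finset.univ _ fun i _ ↦
    katzNormFamily_sum ι r hCP0 Finset.univ _ fun j _ ↦ hm2 i j
  have hS3 := katzSumFamily_sum ι Q Finset.univ _ _ fun i _ ↦
    katzSumFamily_sum ι Q Finset.univ _ _ fun j _ ↦ hm3 i j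
  refine (hKS _ _ _ _ hCP0 hS1 hS2 hS3 M ?_).trans ?_
  · intro m hm
    have h := congrArg (coeff m) hFmap
    rw [PowerSeries.coeff_map, hM m hm, map_zero] at h
    exact h.symm
  · push_cast
    exact katz_gain_bound hx hr hμ hC₀ hkp D₁ D₂ M

end Summit.Langlands.Langlands.Theorems.CapacityClassicality

end
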